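import Summits.ValiantsHypothesis.ValiantsHypothesis.Theorems.BI17LatinCubesAdmissibleTablesCount
import Literature.Computability.AlgebraicComplexity.BI17TableCountFourCutStar
import HarnessLib

/-!
# BI 2017, the `n = 4` Latin-cube fact `BI2017_latinCube_2_4` — DISCHARGED

Bürgisser–Ikenmeyer 2017 (§5.2 before Problem 5.23; §3.3 after Prop. 3.28) record, as a computer
verification, that the signed count of Latin cubes of side `4` is non-zero (equivalently
`P_{4,16}(det_4) ≠ 0`).  The tree now proves it by algebra:
`Literature.….BI17TwoLevelCut.admissibleTableCount_four_pos` (✓ `BI17TableCountFourCutStar`, input seat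
val-input-bi17-latincube4 g0: the 2+2 level cut, the Cayley hyperdeterminant as a Fischer pairing, the
`SO₆ × SO₆` star-invariance of `det K`) gives `admissibleTableCount 4 ≠ 0`, and the Summit-side
equivalence `BI2017_latinCube_2_4_iff_admissibleTableCount_four` (✓ `…BI17LatinCubesAdmissibleTablesCount`,
val-lit-t03/p4/p5 lineage) turns it into the named fact.  This file is the one-line closer
(`--supports` stmt-ValiantsHypothesis-19612, as the LatinCubes files).  The `det` half `P_{4,16}(det_4) ≠ 0` of
`BI2017_P416_det_per` is ALREADY the Literature theorem `BI17TwoLevelCut.cayleyP_det_four_ne_zero` (not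
restated here); the `per` half and hence `BI2017_P416_det_per` itself stay OPEN.  HONEST FRAMING: a published `n = 4` computer check is now a kernel
theorem; nothing here is progress on `VP ≠ VNP`, which is NOT proved; no summit statement is proved by
this file. No definitions, no new named facts. [cite: BurgisserIkenmeyer2017, §5.2 (before Problem 5.23);
§3.3 (after Prop. 3.28)]
-/

namespace Summit.ValiantsHypothesis.BI17LatinCubesAdmissibleTables

open Literature.Computability.AlgebraicComplexity

/-- **`BI2017_latinCube_2_4` holds**: the Latin-cube counts at `n = 2` and `n = 4` are non-zero
(BI 2017 §5.2, there a computer verification; here: `admissibleTableCount_four_pos` by algebra +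
`BI2017_latinCube_2_4_iff_admissibleTableCount_four`).
[cite: BurgisserIkenmeyer2017, §5.2 (before Problem 5.23)] -/
theorem BI2017_latinCube_2_4_holds : BI2017_latinCube_2_4 :=
  BI2017_latinCube_2_4_iff_admissibleTableCount_four.mpr
    (BI17TwoLevelCut.admissibleTableCount_four_pos).ne'

end Summit.ValiantsHypothesis.BI17LatinCubesAdmissibleTables
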